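import Summits.AtomisticToContinuum.Crystallization.Theses.ZeroPressureMagicFunction
import Summits.AtomisticToContinuum.Crystallization.Theorems.ThreeConeCertificateDefectVanishCrystallizes
import Literature.MathematicalPhysics.StatisticalMechanics.LennardJonesClusters

/-!
# Crux `CertificateRigidity3` (stmt-AtomisticToContinuum-12148, route `ZeroPressureMagicFunction`, rank 4) —
# birth skeleton `Lines/birth.lean` (skeleton-register, planner one-shot, 2026-08-17)

The crux (FQ name `Summit.AtomisticToContinuum.Crystallization.Theses.ZeroPressureMagicFunction.CertificateRigidity3`):
every TIGHT zero-pressure pair certificate `(g, P)` for Lennard-Jones in `ℝ³` — `g : ℝ³ → ℝ` continuous, of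
positive type (all finite real quadratic forms `Σ cᵢcⱼ g(xᵢ − xⱼ) ≥ 0`), `g ≤ V_LJ(‖·‖)` off `0`, and a periodic
`P` with `e_LJ(P) = −g(0)/2` — forces positional crystallization `IsCrystallizing lennardJones 3`
(Blanc–Lewin (ii)).  Refuter evidence (Evidence12148.lean, rc 0): the crux is `↔ (MagicFunctionLJ3 →
IsCrystallizing lennardJones 3)`; it is not the summit conjunct and not vacuous.

## The line (two registered stubs + a kernel-checked composition) — the route's own foreseen split
"SlacknessPinning → BraggRigidity" (route header, TWO-LAYER PLAN), typed.

THE SEAM is the complementary-slackness identity of the two-point bound: for an injective `N`-point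
configuration `x`,

  `E_N(x) + N·g(0)/2 = C_N(x) + ½·S_N(x)`,  `C_N(x) = Σ_{i<j} [V_LJ(|xᵢ−xⱼ|) − ½(g(xᵢ−xⱼ) + g(xⱼ−xᵢ))] ≥ 0`
  (CONTACT slack, termwise `≥ 0` by the minorant), `S_N(x) = Σ_{i,j} g(xᵢ − xⱼ) ≥ 0` (SPECTRAL slack, the
  quadratic form at `c ≡ 1`; in Fourier terms `∫ ĝ |Σⱼ e^{2πi⟨ξ,xⱼ⟩}|²`, the structure factor weighted by `ĝ`).

* `stub_slacknessPinning` (M; provable with tree tools) — along Lennard-Jones GROUND STATES both slack DENSITIES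
  vanish: `S_N/N → 0` and `C_N/N → 0`.  Content: the identity above, `E(N)/N ≥ −g(0)/2` (drop the slacks) and
  the matching upper bound `E(N)/N ≤ e_LJ(P) + ε = −g(0)/2 + ε` eventually (tree: `trialStateUpper_proof`,
  from the PROVED thermodynamic limit `BlancLewin2015_8_holds` and blocks of `P` as trial states), squeeze.
* `stub_braggRigidity` (L–XL; load-bearing) — RIGIDITY OF PINNED SEQUENCES: given a tight `(g, P)` there is ONE
  periodic template `P'` such that along EVERY sequence of injective configurations whose two slack densities
  vanish, for every window radius `R` and tolerance `ε`, all but `o(N)` particles `i` admit a linear isometry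
  `A` with the particles in `B_R(xᵢ)` two-way `ε`-matched to `xᵢ + A(P'.points ∩ B̄_R)` (the tree's window
  vocabulary of `ThreeConeCertificate.BulkDefectVanish` / `SlackRigidity`).  Mechanism the certificate offers:
  `C_N = o(N)` pins all but `o(N)` local pair-distance patterns to the contact set `{g_sym = V_LJ}`, `S_N = o(N)`
  pins the averaged structure factor to the zero set `{ĝ = 0}`; uniformly discrete support + spectrum of every
  local autocorrelation limit ⇒ Poisson-comb rigidity (Lev–Olevskii 2015; CKMRV 2022 §6 uniqueness step) ⇒
  crystalline windows.  NOTE (why Sütő-degeneracy is a weakness of the TOOL, not a counterexample): by the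
  identity and the proved energetics, "both slack densities vanish" ⟺ "`E_N(x^N)/N → e_∞`" — the pinned
  sequences are exactly the asymptotically minimising ones, whatever tight `g` is used; the stub is the
  near-minimiser bulk rigidity of Lennard-Jones read through the certificate.

`CertificateRigidity3_of_goals : stub₁-sig → stub₂-sig → <body of CertificateRigidity3>` is PROVED below (no `sorry`
outside the two stubs): ground states are injective and pinned (stub 1), hence have crystalline windows at all but `o(N)`
particles (stub 2); the PROVED uniform minimal distance of Lennard-Jones ground states
(`LennardJonesMinimalDistance_holds`, Xue 1997) and the PROVED soft assembly
`isCrystallizing_of_bulkDefectVanish` (tree, `ThreeConeCertificateDefectVanishCrystallizes.lean`: extraction of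
good particles at every scale, compactness of `O(3)`, local bijection from the minimal distance) give the
Blanc–Lewin local convergence, limit `P'.isometryImage B`, multiplicity `1`.
`CertificateRigidity3_of : CertificateRigidity3` applies it to the two stubs — the ONE theorem of the file concluding
the ROUTE DECL by name, hypothesis-free (kernel check that the stub signatures are consumed verbatim).

## Audit (this file, `lean check --json`): rc 0, errors 0, sorries 2 = the two `stub_*` (zero elsewhere);
`CertificateRigidity3_of_goals` closed (axioms propext / Classical.choice / Quot.sound); `#h21_check_skeleton` (local
replica of `ledger skeleton check`): ok = true, codes [], theorem = `CertificateRigidity3_of`, stubs = {stub_slacknessPinning,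
stub_braggRigidity} (both sorried), sorries = exactly those two.

## BC3 probes (planner folder `bc/probe_*.lean`, importing ONLY the route file, hence the Statement; antecedent =
the stub signature verbatim) — ALL FAIL, as required.  Combined form `set_option maxHeartbeats 400000 in example :
stub → T := by first | exact? | simpa | aesop`: `stub₁ → CertificateRigidity3` rc 1 (heartbeat timeout inside the
combinator); `stub₁ → Crystallization` rc 1 (aesop: failed after exhaustive search, `⊢ Crystallization`);
`stub₂ → CertificateRigidity3` rc 1 (timeout); `stub₂ → Crystallization` rc 1 (timeout).  Split per tactic
(`bc/probe_*_split.lean`, one `example` per tactic, 400000 heartbeats each): `exact?` — "could not close the goal"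
in all four; `simpa` — "Tactic `assumption` failed" in all four; `aesop` — exhaustive-search failure for `stub₁ → crux`
and `stub₁ → S`, heartbeat timeout for `stub₂ → crux` and `stub₂ → S`; the BC.md extras `simpa [T]` and
`unfold T; simpa` — fail in all four.  Neither stub is cheaply the crux or the summit conjunct (`stub₁` carries no
positional information; `stub₂` needs pinning, the minimal distance and the soft assembly before it says anything
about ground states, and says nothing about the energetic conjunct).

## Disproof used
No `Disproof.lean` exists for 12148 (`ledger crux ls`: no workfiles at registration).  Refuter structure lemmas
(Evidence12148.lean): `sig_iff` (crux ↔ X₃ → BL(ii)) — honoured: the skeleton's only route-external inputs are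
PROVED tree theorems, so `stub₁ ∧ stub₂` is genuinely stronger information than the crux, not a rewording;
`isLeast_of_tight` (a tight `P` is a periodic minimiser) is the reason `stub₂` may quantify one template `P'` for
all pinned sequences.  Negatives index (20 refuted statements, 2026-08-17): the Crystallization entries
(12-sphere shell census at 1/50, one-multiplier spectral pricing, EffectiveLocalHales at 1/100, OneGrainGluing)
are local-geometry / pricing statements; neither stub is an instance or a rewording of any of them.
-/

noncomputable section

namespace Summit.AtomisticToContinuum.Crystallization.Cruxes.CertificateRigidity3.Birth

open Literature.MathematicalPhysics.StatisticalMechanics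
open Summit.AtomisticToContinuum.Crystallization.Theses.ZeroPressureMagicFunction
open Summit.AtomisticToContinuum.Crystallization.Theorems.ThreeConeCertificateDefectVanishCrystallizes
  (isCrystallizing_of_bulkDefectVanish)
open Filter Topology
open scoped BigOperators

/-! ## The two registered stubs -/

/-- **stub_slacknessPinning — SLACKNESS PINNING along ground states (M; provable with tree tools).**
For every tight zero-pressure pair certificate `(g, P)` (the four hypotheses of the crux, verbatim) and every
sequence of Lennard-Jones ground states `x^N` in `ℝ³`, both slack densities of the two-point bound vanish:
the SPECTRAL slack `(1/N) Σ_{i,j} g(xᵢ − xⱼ) → 0` and the CONTACT slack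
`(1/N) Σ_{i<j} [V_LJ(|xᵢ − xⱼ|) − ½(g(xᵢ − xⱼ) + g(xⱼ − xᵢ))] → 0`.
WHY PLAUSIBLE (indeed provable now): the identity `E_N(x) + N g(0)/2 = C_N + ½ S_N` (diagonal/off-diagonal
split of the double sum; `dist = ‖· − ·‖`, injectivity gives `xᵢ − xⱼ ≠ 0`), both slacks `≥ 0` (minorant in
both orientations; positive type at `c ≡ 1`), and `E(N)/N ≤ e_LJ(P) + ε = −g(0)/2 + ε` eventually
(`Summit.AtomisticToContinuum.Crystallization.Theorems.trialStateUpper_proof`, PROVED from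
`BlancLewin2015_8_holds`), so `C_N/N + ½ S_N/N ≤ ε` eventually.  WHY IT MIGHT FAIL: it does not (modulo
Finset bookkeeping); the only trap is the `tsum`/`⨅` junk audit, already cleared for Lennard-Jones in `d = 3`
(refuter review of the route).  NOT the crux: no positional conclusion at all.
LEANS ON: `IsGroundState`, `groundStateEnergy`, `PeriodicConfiguration.energyPerParticle`, `lennardJones`
(Literature); `trialStateUpper_proof` (tree); sources Ruelle1969 Prop. 3.2.7, CohnKumar2006 §9 Prop. 9.3,
BlancLewin2015 §1.3 (8). -/
theorem stub_slacknessPinning : ∀ (g : EuclideanSpace ℝ (Fin 3) → ℝ) (P : Literature.MathematicalPhysics.StatisticalMechanics.PeriodicConfiguration 3), Continuous g → (∀ (n : ℕ) (x : Fin n → EuclideanSpace ℝ (Fin 3)) (c : Fin n → ℝ), 0 ≤ ∑ i, ∑ j, c i * c j * g (x i - x j)) → (∀ x : EuclideanSpace ℝ (Fin 3), x ≠ 0 → g x ≤ Literature.MathematicalPhysics.StatisticalMechanics.lennardJones ‖x‖) → P.energyPerParticle Literature.MathematicalPhysics.StatisticalMechanics.lennardJones = -(g 0) / 2 → ∀ x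 : (N : ℕ) → (Fin N → EuclideanSpace ℝ (Fin 3)), (∀ N, Literature.MathematicalPhysics.StatisticalMechanics.IsGroundState Literature.MathematicalPhysics.StatisticalMechanics.lennardJones (x N)) → Filter.Tendsto (fun N : ℕ => (∑ i, ∑ j, g (x N i - x N j)) / N) Filter.atTop (nhds 0) ∧ Filter.Tendsto (fun N : ℕ => (∑ i, ∑ j ∈ Finset.Ioi i, (Literature.MathematicalPhysics.StatisticalMechanics.lennardJones (dist (x N i) (x N j)) - (g (x N i - x N j) + g (x N j - x N i)) / 2)) / N) Filter.atTop (nhds 0) := by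
  sorry

/-- **stub_braggRigidity — RIGIDITY OF PINNED SEQUENCES (L–XL; the load-bearing stub).**
For every tight zero-pressure pair certificate `(g, P)` there is ONE periodic template `P'` (expected: the
Lennard-Jones-optimal hcp with `0` in the motif) such that for every window radius `R > 0` and tolerance
`ε > 0`, along every sequence of INJECTIVE configurations `x^N` whose spectral and contact slack densities both
vanish, the density of particles `i` admitting NO linear isometry `A` with the particles in `B_R(xᵢ)` two-way
`ε`-matched to `xᵢ + A(P'.points ∩ B̄_R)` tends to `0` (window vocabulary of the tree hinge
`ThreeConeCertificate.BulkDefectVanish` / crux `SlackRigidity`, verbatim).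
WHY PLAUSIBLE: vanishing contact slack pins, by Markov, all but `o(N)` local pair-distance patterns to the contact
set `{g_sym = V_LJ}`; vanishing spectral slack pins the averaged structure factor to `{ĝ = 0}`; every local
(recentred, vague) limit is then a uniformly discrete set whose autocorrelation has uniformly discrete support AND
spectrum, and such measures are finite unions of lattice Dirac combs (Lev–Olevskii 2015 quasicrystal rigidity;
the uniqueness step of Cohn–Kumar–Miller–Radchenko–Viazovska 2022 §6 is the `d = 8, 24` instance) — the
certificate converts energy slack into diffraction data.  Equivalently (identity of stub 1 + proved energetics):
the pinned sequences are exactly the asymptotically minimising ones, `E_N(x^N)/N → e_∞`, so this is near-minimiser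
bulk rigidity of Lennard-Jones, for which the independent real-space evidence is the Hägg-coupling selection of hcp
among Barlow stackings (`e(fcc) − e(hcp) ≈ 7·10⁻⁵`) and soft twelve-coordination.
WHY IT MIGHT FAIL: (a) ONE template for all pinned sequences needs a unique periodic minimiser up to isometry with
positive stacking-fault and phonon stiffness — an exact polytype tie or an aperiodic optimal stacking (Hägg margin
`~10⁻⁴`, uncertified) breaks it (same risk as `SlackRigidity`, stmt-11960); (b) a DEGENERATE tight `g` (contact set
or `{ĝ = 0}` not uniformly discrete — Sütő-type band-limited examples, barrier `SutoDegenerateGroundStates`) makes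
the slackness route uninformative, though not the statement false; (c) homometry: diffraction data determine the
autocorrelation, not the configuration, so the passage "Poisson-comb autocorrelation ⇒ locally periodic
configuration" needs the contact pinning as well.  NOT the crux: it concerns near-minimisers (not ground states),
concludes windows (not vague limits), and gives `IsCrystallizing` only after stub 1, the minimal distance and the
soft assembly; it says nothing about the energetic conjunct.
LEANS ON: `PeriodicConfiguration.points`, `lennardJones` (Literature), Mathlib `LinearIsometry`; sources
LevOlevskii2015 (Invent. Math. 200), CohnEtAl2019/CKMRV2022 §6, SutoPRL2005, BlancLewin2015 §2.3, Stillinger2001. -/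
theorem stub_braggRigidity : ∀ (g : EuclideanSpace ℝ (Fin 3) → ℝ) (P : Literature.MathematicalPhysics.StatisticalMechanics.PeriodicConfiguration 3), Continuous g → (∀ (n : ℕ) (x : Fin n → EuclideanSpace ℝ (Fin 3)) (c : Fin n → ℝ), 0 ≤ ∑ i, ∑ j, c i * c j * g (x i - x j)) → (∀ x : EuclideanSpace ℝ (Fin 3), x ≠ 0 → g x ≤ Literature.MathematicalPhysics.StatisticalMechanics.lennardJones ‖x‖) → P.energyPerParticle Literature.MathematicalPhysics.StatisticalMechanics.lennardJones = -(g 0) / 2 → ∃ P' : Literature.MathematicalPhysics.StatisticalMechanics.PeriodicConfiguration 3, ∀ R ε : ℝ, 0 < R → 0 < ε → ∀ x : (N : ℕ) → (Fin N → EuclideanSpace ℝ (Fin 3)), (∀ N, Function.Injective (x N)) → Filter.Tendsto (fun N : ℕ => (∑ i, ∑ j, g (x N i - x N j)) / N) Filter.atTop (nhds 0) → Filter.Tendsto (fun N : ℕ => (∑ i, ∑ j ∈ Finset.Ioi i, (Literature.MathematicalPhysics.StatisticalMechanics.lennardJones (dist (x N i) (x N j)) - (g (x N i - x N j) + g (x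 N j - x N i)) / 2)) / N) Filter.atTop (nhds 0) → Filter.Tendsto (fun N : ℕ => (Nat.card {i : Fin N // ¬ ∃ A : EuclideanSpace ℝ (Fin 3) →ₗᵢ[ℝ] EuclideanSpace ℝ (Fin 3), (∀ p ∈ P'.points, ‖p‖ ≤ R → ∃ j : Fin N, dist (x N j) (x N i + A p) ≤ ε) ∧ (∀ j : Fin N, dist (x N j) (x N i) ≤ R → ∃ p ∈ P'.points, dist (x N j) (x N i + A p) ≤ ε)} : ℝ) / N) Filter.atTop (nhds 0) := by
  sorry

/-! ## Proved composition (sorry-free below this line) -/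

/-- **Composition `CertificateRigidity3_of_goals`: the two stub STATEMENTS (verbatim, as hypotheses) imply the crux
STATEMENT** (conclusion = the body of the route decl `ZeroPressureMagicFunction.CertificateRigidity3`, written out, so
that `CertificateRigidity3_of` below is the ONE theorem of this file concluding the route decl BY NAME — the shape
`ledger skeleton check` audits).  Real proof, no `sorry`: ground states are injective and pinned (hypothesis 1), hence
have crystalline windows at all but `o(N)` particles (hypothesis 2); the proved uniform minimal distance
`LennardJonesMinimalDistance_holds` and the proved soft assembly `isCrystallizing_of_bulkDefectVanish` give
`IsCrystallizing lennardJones 3`. [folklore] -/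
theorem CertificateRigidity3_of_goals :
    (∀ (g : EuclideanSpace ℝ (Fin 3) → ℝ) (P : Literature.MathematicalPhysics.StatisticalMechanics.PeriodicConfiguration 3), Continuous g → (∀ (n : ℕ) (x : Fin n → EuclideanSpace ℝ (Fin 3)) (c : Fin n → ℝ), 0 ≤ ∑ i, ∑ j, c i * c j * g (x i - x j)) → (∀ x : EuclideanSpace ℝ (Fin 3), x ≠ 0 → g x ≤ Literature.MathematicalPhysics.StatisticalMechanics.lennardJones ‖x‖) → P.energyPerParticle Literature.MathematicalPhysics.StatisticalMechanics.lennardJones = -(g 0) / 2 → ∀ x : (N : ℕ) → (Fin N → EuclideanSpace ℝ (Fin 3)), (∀ N, Literature.MathematicalPhysics.StatisticalMechanics.IsGroundState Literature.MathematicalPhysics.StatisticalMechanics.lennardJones (x N)) → Filter.Tendsto (fun N : ℕ => (∑ i, ∑ j, g (x N i - x N j)) / N) Filter.atTop (nhds 0) ∧ Filter.Tendsto (fun N : ℕ => (∑ i, ∑ j ∈ Finset.Ioi i, (Literature.MathematicalPhysics.StatisticalMechanics.lennardJones (dist (x N i) (x N j)) - (g (x N i - x N j) + g (x N j - x N i))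 / 2)) / N) Filter.atTop (nhds 0)) →
    (∀ (g : EuclideanSpace ℝ (Fin 3) → ℝ) (P : Literature.MathematicalPhysics.StatisticalMechanics.PeriodicConfiguration 3), Continuous g → (∀ (n : ℕ) (x : Fin n → EuclideanSpace ℝ (Fin 3)) (c : Fin n → ℝ), 0 ≤ ∑ i, ∑ j, c i * c j * g (x i - x j)) → (∀ x : EuclideanSpace ℝ (Fin 3), x ≠ 0 → g x ≤ Literature.MathematicalPhysics.StatisticalMechanics.lennardJones ‖x‖) → P.energyPerParticle Literature.MathematicalPhysics.StatisticalMechanics.lennardJones = -(g 0) / 2 → ∃ P' : Literature.MathematicalPhysics.StatisticalMechanics.PeriodicConfiguration 3, ∀ R ε : ℝ, 0 < R → 0 < ε → ∀ x : (N : ℕ) → (Fin N → EuclideanSpace ℝ (Fin 3)), (∀ N, Function.Injective (x N)) → Filter.Tendsto (fun N : ℕ => (∑ i, ∑ j, g (x N i - x N j)) / N) Filter.atTop (nhds 0) → Filter.Tendsto (fun N : ℕ => (∑ i, ∑ j ∈ Finset.Ioi i, (Literature.MathematicalPhysics.StatisticalMechanics.lennardJones (dist (x N i) (x N j)) - (g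 (x N i - x N j) + g (x N j - x N i)) / 2)) / N) Filter.atTop (nhds 0) → Filter.Tendsto (fun N : ℕ => (Nat.card {i : Fin N // ¬ ∃ A : EuclideanSpace ℝ (Fin 3) →ₗᵢ[ℝ] EuclideanSpace ℝ (Fin 3), (∀ p ∈ P'.points, ‖p‖ ≤ R → ∃ j : Fin N, dist (x N j) (x N i + A p) ≤ ε) ∧ (∀ j : Fin N, dist (x N j) (x N i) ≤ R → ∃ p ∈ P'.points, dist (x N j) (x N i + A p) ≤ ε)} : ℝ) / N) Filter.atTop (nhds 0)) →
    ∀ (g : EuclideanSpace ℝ (Fin 3) → ℝ) (P : Literature.MathematicalPhysics.StatisticalMechanics.PeriodicConfiguration 3), Continuous g → (∀ (n : ℕ) (x : Fin n → EuclideanSpace ℝ (Fin 3)) (c : Fin n → ℝ), 0 ≤ ∑ i, ∑ j, c i * c j * g (x i - x j)) → (∀ x : EuclideanSpace ℝ (Fin 3), x ≠ 0 → g x ≤ Literature.MathematicalPhysics.StatisticalMechanics.lennardJones ‖x‖) → P.energyPerParticle Literature.MathematicalPhysics.StatisticalMechanics.lennardJones = -(g 0) / 2 → Literature.MathematicalPhysics.StatisticalMechanics.IsCrystallizing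 Literature.MathematicalPhysics.StatisticalMechanics.lennardJones 3 := by
  intro h₁ h₂ g P hc hpd hmin htight
  obtain ⟨P', hP'⟩ := h₂ g P hc hpd hmin htight
  have hmd := Literature.MathematicalPhysics.StatisticalMechanics.LennardJonesMinimalDistance_holds
  unfold Literature.MathematicalPhysics.StatisticalMechanics.LennardJonesMinimalDistance at hmd
  obtain ⟨δ, hδ, hsep⟩ := hmd
  refine isCrystallizing_of_bulkDefectVanish P' (fun R ε hR hε x hx => ?_) hδ hsep
  obtain ⟨hspec, hcont⟩ := h₁ g P hc hpd hmin htight x hx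
  have hinj : ∀ N, Function.Injective (x N) := fun N => by
    have h := hx N
    unfold Literature.MathematicalPhysics.StatisticalMechanics.IsGroundState at h
    exact h.1
  exact hP' R ε hR hε x hinj hspec hcont

/-- **The skeleton IS the crux proof modulo the two named stubs** — `ZeroPressureMagicFunction.CertificateRigidity3`
BY NAME (hypothesis-free), from `stub_slacknessPinning` and `stub_braggRigidity` through the sorry-free
`CertificateRigidity3_of_goals`; the kernel checks here that the stub signatures are consumed verbatim and that the
composed statement is definitionally the route decl.  The only `sorry`s in its cone are the two stubs. -/
theorem CertificateRigidity3_of :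
    Summit.AtomisticToContinuum.Crystallization.Theses.ZeroPressureMagicFunction.CertificateRigidity3 :=
  CertificateRigidity3_of_goals stub_slacknessPinning stub_braggRigidity

end Summit.AtomisticToContinuum.Crystallization.Cruxes.CertificateRigidity3.Birth

end
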